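import Summits.QuantumFields.YangMills.Theorems.LangevinControlUVFemtoCurvatureSkewnessCDominatedDescent
import Summits.QuantumFields.YangMills.Theorems.FemtoCurvatureSkewnessC.Negative.ClausesAndFreedom

/-!
# Crux `FemtoCurvatureSkewnessC` (stmt-QuantumFields-16205), line `ratio-transport`: v3's engine implies v4's stubs; skeleton v4's assembly

Lead `prover-line-stmt-QuantumFields-16205-c1-0` (line lead, cycle 2, 2026-08-16).  Second companion proof file of the vocabulary (C)
`LangevinControlUVFemtoCurvatureSkewnessCRatioTransportDefsC.lean` (p125065).  Theorems only, no `sorry`, nothing posited; inputs: the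
dominated descent (`…CDominatedDescent.lean`), the landed ruler rigidity in package vocabulary (`continuous_package_maps_comparable`,
`Theorems/FemtoCurvatureSkewnessC/Negative/ClausesAndFreedom.lean` p122784), the landed floor ⇒ rigidity composition
(`signedRigidity_of_ratioFloor`, p123064), `skewnessPackage_of_signedRigidity` and `femtoCurvatureSkewnessC_iff` (landed).

* § Weakening — `engines_of_ratioTransportEngine : RatioTransportEngine → CutoffEngine ∧ VolumeEngine ∧ SeparationEngine`
  (skeleton v3's engine implies skeleton v4's three: v3's honest package map is dominated by the hypothesis map by ruler rigidity,
  so it witnesses `CutoffEngine`, and its volume / separation transports transfer to the hypothesis map).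
* § Assembly — `femtoCurvatureSkewnessC_of_engines : CutoffEngine → VolumeEngine → SeparationEngine → Anchors → FemtoCurvatureSkewnessC`
  (the served crux BY NAME modulo the four stubs of skeleton v4 — CONDITIONAL, nothing asserted; output map = hypothesis map).  Composing
  with the weakening reproduces the landed `femtoCurvatureSkewnessC_of_ratioTransport` (v3's pair ⇒ crux): v4 loses nothing.
-/

set_option autoImplicit false

noncomputable section

namespace Summit.QuantumFields.YangMills.Cruxes.FemtoCurvatureSkewnessC.RatioTransport

open MeasureTheory Filter Topology
open Literature.MathematicalPhysics.QuantumFieldTheory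
open Summit.QuantumFields.YangMills.Theorems.FemtoCurvatureSkewness.Negative (TwoPointPackage SkewnessPackage)
open Summit.QuantumFields.YangMills.Cruxes.FemtoCurvatureSkewness.CouplingCubicResponse
  (IsHonestUnitMap SignedRigidity skewnessPackage_of_signedRigidity)
open Summit.QuantumFields.YangMills.Theses.LangevinControlUV (FemtoCurvatureSkewnessC)
open Summit.QuantumFields.YangMills.Theorems.FemtoCurvatureSkewness (femtoCurvatureSkewnessC_iff)
open Summit.QuantumFields.YangMills.Theorems.FemtoCurvatureSkewnessC.Negative (continuous_package_maps_comparable)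

/-! ## § Weakening — skeleton v3's engine implies skeleton v4's three stubs -/

/-- **Old E ⇒ new E_c, E_v, E_s.**  If some honest map `a` carries the package and the three transports (skeleton v3's
`RatioTransportEngine`), then for EVERY continuous package map `a₀` of the same `(G, r)`: `a` is dominated by `a₀` (landed ruler
rigidity `continuous_package_maps_comparable`, one direction), so `a` witnesses `CutoffEngine`, and its volume / separation transports
transfer to `a₀`. -/
theorem engines_of_ratioTransportEngine (hE : RatioTransportEngine) :
    CutoffEngine ∧ VolumeEngine ∧ SeparationEngine := by
  have key : ∀ (G : Type) [Group G] [TopologicalSpace G] [IsTopologicalGroup G] [CompactSpace G]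
      [MeasurableSpace G] [BorelSpace G], IsCompactSimpleLieGroup G →
      ∀ (r : LatticeRep G) (a₀ : ℝ → ℝ), Continuous a₀ → TwoPointPackage r a₀ →
        ∃ a : ℝ → ℝ, Continuous a ∧ (∀ β, 0 < a β) ∧ Dominated a a₀ ∧ CutoffTransport r a ∧
          VolumeTransport r a ∧ SeparationTransport r a := by
    intro G _ _ _ _ _ _ hG r a₀ ha₀ hP₀
    obtain ⟨a, ha, hP, hc, hv, hs⟩ := hE G hG r ⟨a₀, ha₀, hP₀⟩
    obtain ⟨K, β₃, hK, hKβ⟩ := continuous_package_maps_comparable r hP₀ hP ha₀ ha.2.2.1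
    exact ⟨a, ha.2.2.1, ha.1, ⟨K, β₃, hK, fun β hβ => (hKβ β hβ).1⟩, hc, hv, hs⟩
  refine ⟨?_, ?_, ?_⟩
  · intro G _ _ _ _ _ _ hG r a₀ ha₀ hP₀
    obtain ⟨a, ha, hpos, hdom, hc, -, -⟩ := key G hG r a₀ ha₀ hP₀
    exact ⟨a, ha, hpos, hdom, hc⟩
  · intro G _ _ _ _ _ _ hG r a₀ ha₀ hP₀
    obtain ⟨a, -, -, hdom, -, hv, -⟩ := key G hG r a₀ ha₀ hP₀
    exact volumeTransport_of_dominated r hv hdom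
  · intro G _ _ _ _ _ _ hG r a₀ ha₀ hP₀
    obtain ⟨a, -, -, hdom, -, -, hs⟩ := key G hG r a₀ ha₀ hP₀
    exact separationTransport_of_dominated r hs hdom

/-! ## § Assembly — skeleton v4 closes the served crux modulo E_c, E_v, E_s and A -/

/-- **Signed rigidity in the femto boxes of the HYPOTHESIS map**, from the three engine stubs and the anchors: the cutoff chain runs
in the engine's dominated map, everything else in `a₀`'s boxes; then floor ⇒ rigidity by `a₀`'s own package (landed
`signedRigidity_of_ratioFloor`). -/
theorem signedRigidity_of_engines {G : Type} [Group G] [TopologicalSpace G] [IsTopologicalGroup G] [CompactSpace G]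
    [MeasurableSpace G] [BorelSpace G] (hG : IsCompactSimpleLieGroup G) (hc : CutoffEngine) (hv : VolumeEngine)
    (hs : SeparationEngine) (r : LatticeRep G) (hA : FixedTorusAnchors r) {a₀ : ℝ → ℝ} (ha₀ : Continuous a₀)
    (hP₀ : TwoPointPackage r a₀) : SignedRigidity r a₀ := by
  obtain ⟨a, ha, hpos, hdom, hcut⟩ := hc G hG r a₀ ha₀ hP₀
  obtain ⟨Γ, β₀, ℓ₀, c, C, -, -, hpos₀, -, -⟩ := id hP₀
  exact signedRigidity_of_ratioFloor r hP₀
    (ratioFloor_of_dominated_transports r a a₀ hpos ha hpos₀ hdom hA hcut (hv G hG r a₀ ha₀ hP₀) (hs G hG r a₀ ha₀ hP₀))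

/-- **Skeleton v4's composition: the line `ratio-transport` closes the served crux BY NAME modulo exactly E_c, E_v, E_s and A**
(CONDITIONAL on the four route-posited stubs; nothing asserted).  The output map is the hypothesis map `a₀` itself — continuous and
package-carrying by hypothesis — with the skewness package from `skewnessPackage_of_signedRigidity` (landed) and the route decl from
`femtoCurvatureSkewnessC_iff` (landed, `Iff.rfl`). -/
theorem femtoCurvatureSkewnessC_of_engines (hc : CutoffEngine) (hv : VolumeEngine) (hs : SeparationEngine) (hA : Anchors) :
    FemtoCurvatureSkewnessC := by
  rw [femtoCurvatureSkewnessC_iff]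
  intro G _ _ _ _ hG
  letI : MeasurableSpace G := borel G
  haveI : BorelSpace G := ⟨rfl⟩
  intro r hex
  obtain ⟨a₀, ha₀, hP₀⟩ := hex
  exact ⟨a₀, ha₀, hP₀, skewnessPackage_of_signedRigidity r hP₀
    (signedRigidity_of_engines hG hc hv hs r (hA G hG r ⟨a₀, ha₀, hP₀⟩) ha₀ hP₀)⟩

end Summit.QuantumFields.YangMills.Cruxes.FemtoCurvatureSkewnessC.RatioTransport

end
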